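import Literature.Probability.RandomPlanarGeometry.PolygonalDomains
import HarnessLib

/-!
# The inverted exterior of a Jordan domain

Topic `Literature/Probability/RandomPlanarGeometry`; family `conformal-planar`. For a Jordan domain
`D` and a point `z₀ ∈ D`, the inversion `ι(z) = (z - z₀)⁻¹` carries the exterior
`E = ℂ ∖ closure D` of `D`, together with the point at infinity, onto a bounded Jordan domain
`D* = ι(E) ∪ {0}` whose boundary loop is `ι ∘ ∂D` (`JordanDomain.inverted`). This is the
standard device for transporting interior constructions (Riemann map, Carathéodory extension,
interior collars) to the exterior of a Jordan curve (Pommerenke, *Boundary Behaviour of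
Conformal Maps* (1992), §1.2–§2.1: the exterior map; Bollobás–Riordan, *Percolation* (2006),
Ch. 7 p. 186, where neighbourhoods of a Jordan domain on both sides of its boundary are needed).

* `invMap z₀ z = (z - z₀)⁻¹`, `invMapInv z₀ w = z₀ + w⁻¹`: mutually inverse bijections of `ℂ`
  (with `0⁻¹ = 0`), continuous off `z₀`, resp. off `0`.
* `JordanDomain.inverted D hz₀`: carrier `ι(E) ∪ {0}`, boundary `ι ∘ D.boundary`; it is open,
  bounded, connected (the exterior is connected and unbounded: `exterior_of_JCT`), and its
  frontier is `ι(∂D)`.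

## References

* Ch. Pommerenke, *Boundary Behaviour of Conformal Maps*, Springer (1992), §2.1.
* B. Bollobás, O. Riordan, *Percolation*, Cambridge University Press (2006), Ch. 7 p. 186.

## Mathlib / tree

Mathlib: `inv`, `closure_compl`, `frontier_closure_subset`, `ContinuousWithinAt.mem_closure_image`,
`IsConnected.image`, `IsConnected.subset_closure`. Tree: `PlanarDomains` (`JordanDomain`),
`PlanarDomainsTopology` (`exterior_of_JCT`), `JordanCurveProofs` (`JordanCurveTheorem_holds`).
-/

noncomputable section

open Set Metric Topology Filter Bornology

namespace Literature.Probability.RandomPlanarGeometry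

/-! ### The inversion and its inverse -/

/-- The inversion `ι(z) = (z - z₀)⁻¹` centred at `z₀` (with `ι(z₀) = 0`). [folklore] -/
def invMap (z₀ z : ℂ) : ℂ := (z - z₀)⁻¹

/-- Its inverse `κ(w) = z₀ + w⁻¹` (with `κ(0) = z₀`). [folklore] -/
def invMapInv (z₀ w : ℂ) : ℂ := z₀ + w⁻¹

/-- `κ ∘ ι = id`. [folklore] -/
@[simp] theorem invMapInv_invMap (z₀ z : ℂ) : invMapInv z₀ (invMap z₀ z) = z := by
  simp [invMap, invMapInv]

/-- `ι ∘ κ = id`. [folklore] -/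
@[simp] theorem invMap_invMapInv (z₀ w : ℂ) : invMap z₀ (invMapInv z₀ w) = w := by
  simp [invMap, invMapInv]

/-- `ι` is injective. [folklore] -/
theorem invMap_injective (z₀ : ℂ) : Function.Injective (invMap z₀) := fun z z' h => by
  rw [← invMapInv_invMap z₀ z, h, invMapInv_invMap]

/-- `ι z = 0 ↔ z = z₀`. [folklore] -/
theorem invMap_eq_zero_iff {z₀ z : ℂ} : invMap z₀ z = 0 ↔ z = z₀ := by
  rw [invMap, inv_eq_zero, sub_eq_zero]

/-- `κ w = z₀ ↔ w = 0`. [folklore] -/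
theorem invMapInv_eq_iff {z₀ w : ℂ} : invMapInv z₀ w = z₀ ↔ w = 0 := by
  rw [invMapInv, add_eq_left, inv_eq_zero]

/-- `‖ι z‖ = ‖z - z₀‖⁻¹`. [folklore] -/
theorem norm_invMap (z₀ z : ℂ) : ‖invMap z₀ z‖ = ‖z - z₀‖⁻¹ := by
  rw [invMap, norm_inv]

/-- `‖κ w - z₀‖ = ‖w‖⁻¹`. [folklore] -/
theorem norm_invMapInv_sub (z₀ w : ℂ) : ‖invMapInv z₀ w - z₀‖ = ‖w‖⁻¹ := by
  rw [invMapInv, add_sub_cancel_left, norm_inv]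

/-- `ι` is continuous at every `z ≠ z₀`. [folklore] -/
theorem continuousAt_invMap {z₀ z : ℂ} (hz : z ≠ z₀) : ContinuousAt (invMap z₀) z :=
  ((continuous_id.sub continuous_const).continuousAt).inv₀ (sub_ne_zero.2 hz)

/-- `κ` is continuous at every `w ≠ 0`. [folklore] -/
theorem continuousAt_invMapInv {z₀ w : ℂ} (hw : w ≠ 0) : ContinuousAt (invMapInv z₀) w :=
  continuousAt_const.add (continuousAt_id.inv₀ hw)

/-- `ι` is continuous off `z₀`. [folklore] -/
theorem continuousOn_invMap (z₀ : ℂ) : ContinuousOn (invMap z₀) {z₀}ᶜ := fun _ hz =>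
  (continuousAt_invMap hz).continuousWithinAt

/-- `κ` is continuous off `0`. [folklore] -/
theorem continuousOn_invMapInv (z₀ : ℂ) : ContinuousOn (invMapInv z₀) {0}ᶜ := fun _ hw =>
  (continuousAt_invMapInv hw).continuousWithinAt

/-- Membership in an `ι`-image: `w ∈ ι '' S ↔ κ w ∈ S`. [folklore] -/
theorem mem_image_invMap_iff {z₀ : ℂ} {S : Set ℂ} {w : ℂ} : w ∈ invMap z₀ '' S ↔ invMapInv z₀ w ∈ S := by
  constructor
  · rintro ⟨z, hz, rfl⟩; rwa [invMapInv_invMap]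
  · intro h; exact ⟨_, h, invMap_invMapInv z₀ w⟩

namespace JordanDomain

variable (D : JordanDomain) {z₀ : ℂ}

/-- `z₀ ∈ D` is not in the exterior `ℂ ∖ closure D`, and neither is any point of `∂D`.
[folklore] -/
theorem not_mem_compl_closure_of_mem (hz₀ : z₀ ∈ D.carrier) : z₀ ∉ (closure D.carrier)ᶜ :=
  fun h => h (subset_closure hz₀)

/-- Boundary points are not `z₀ ∈ D`. [folklore] -/
theorem boundary_ne_of_mem (hz₀ : z₀ ∈ D.carrier) (t : ℝ) : D.boundary t ≠ z₀ := fun h =>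
  Set.disjoint_left.1 D.disjoint_carrier_frontier hz₀ (h ▸ D.boundary_mem_frontier t)

/-- A ball about `z₀ ∈ D` inside `D`, in radius form: some `s > 0` with `‖z - z₀‖ ≥ s` for every
`z ∉ D`. [folklore] -/
theorem exists_pos_le_norm_sub_of_not_mem (hz₀ : z₀ ∈ D.carrier) :
    ∃ s > 0, ∀ z ∉ D.carrier, s ≤ ‖z - z₀‖ := by
  obtain ⟨s, hs, hball⟩ := Metric.isOpen_iff.1 D.isOpen z₀ hz₀
  refine ⟨s, hs, fun z hz => ?_⟩
  by_contra hlt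
  push Not at hlt
  exact hz (hball (mem_ball_iff_norm.2 hlt))

/-- A radius `R₀ > 0` with `closure D ⊆ closedBall z₀ R₀`. [folklore] -/
theorem exists_closure_subset_closedBall (z₀ : ℂ) : ∃ R₀ > 0, closure D.carrier ⊆ closedBall z₀ R₀ := by
  obtain ⟨R, hR⟩ := D.isBounded.closure.subset_closedBall z₀
  exact ⟨max R 1, by positivity, hR.trans (closedBall_subset_closedBall (le_max_left _ _))⟩

/-- The carrier `ι(ℂ ∖ closure D) ∪ {0}` of the inverted exterior. [folklore] -/
def invCarrier (D : JordanDomain) (z₀ : ℂ) : Set ℂ := invMap z₀ '' (closure D.carrier)ᶜ ∪ {0}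

/-- Membership in the inverted carrier: `w = 0` or `κ w` is exterior. [folklore] -/
theorem mem_invCarrier_iff {w : ℂ} : w ∈ D.invCarrier z₀ ↔ w = 0 ∨ invMapInv z₀ w ∉ closure D.carrier := by
  rw [invCarrier, mem_union, mem_singleton_iff, mem_image_invMap_iff, or_comm, mem_compl_iff]

/-- `0` (the image of `∞`) lies in the inverted carrier. [folklore] -/
theorem zero_mem_invCarrier : (0 : ℂ) ∈ D.invCarrier z₀ := Or.inr rfl

/-- `ι` of an exterior point lies in the inverted carrier. [folklore] -/
theorem invMap_mem_invCarrier {z : ℂ} (hz : z ∉ closure D.carrier) : invMap z₀ z ∈ D.invCarrier z₀ :=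
  Or.inl ⟨z, hz, rfl⟩

/-- The inverted carrier is open. [folklore] -/
theorem isOpen_invCarrier (hz₀ : z₀ ∈ D.carrier) : IsOpen (D.invCarrier z₀) := by
  obtain ⟨R₀, hR₀, hR⟩ := D.exists_closure_subset_closedBall z₀
  -- a ball about `0` inside
  have hball : ball (0 : ℂ) R₀⁻¹ ⊆ D.invCarrier z₀ := by
    intro w hw
    by_cases hw0 : w = 0
    · exact Or.inr hw0
    · refine Or.inl (mem_image_invMap_iff.2 fun hmem => ?_)
      have h1 := hR hmem
      rw [mem_closedBall, dist_eq_norm, norm_invMapInv_sub] at h1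
      have h2 : R₀ < ‖w‖⁻¹ := (lt_inv_comm₀ (norm_pos_iff.2 hw0) hR₀).1 (mem_ball_zero_iff.1 hw)
      linarith
  have hopen : IsOpen ({(0 : ℂ)}ᶜ ∩ invMapInv z₀ ⁻¹' (closure D.carrier)ᶜ) :=
    (continuousOn_invMapInv z₀).isOpen_inter_preimage isOpen_compl_singleton isClosed_closure.isOpen_compl
  rw [isOpen_iff_mem_nhds]
  rintro w (hw | hw)
  · have hw0 : w ≠ 0 := by
      rintro rfl
      obtain ⟨z, hz, hz0⟩ := hw
      exact hz (invMap_eq_zero_iff.1 hz0 ▸ subset_closure hz₀)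
    refine Filter.mem_of_superset (hopen.mem_nhds ⟨hw0, mem_image_invMap_iff.1 hw⟩) fun w' hw' => ?_
    exact Or.inl (mem_image_invMap_iff.2 hw'.2)
  · rw [mem_singleton_iff.1 hw]
    exact Filter.mem_of_superset (ball_mem_nhds _ (inv_pos.2 hR₀)) hball

/-- The inverted carrier is bounded (by `s⁻¹` if `B(z₀, s) ⊆ D`). [folklore] -/
theorem isBounded_invCarrier (hz₀ : z₀ ∈ D.carrier) : IsBounded (D.invCarrier z₀) := by
  obtain ⟨s, hs, hfar⟩ := D.exists_pos_le_norm_sub_of_not_mem hz₀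
  refine (isBounded_closedBall (x := (0 : ℂ)) (r := s⁻¹)).subset ?_
  rintro w (⟨z, hz, rfl⟩ | hw)
  · rw [mem_closedBall, dist_zero_right, norm_invMap]
    have h1 := hfar z fun h => hz (subset_closure h)
    exact (inv_le_inv₀ (hs.trans_le h1) hs).2 h1
  · rw [mem_singleton_iff.1 hw, mem_closedBall, dist_self]; positivity

/-- The inverted carrier is connected (the exterior is connected and unbounded, and `0` is a
limit of images of far exterior points). [folklore] -/
theorem isConnected_invCarrier (hz₀ : z₀ ∈ D.carrier) : IsConnected (D.invCarrier z₀) := by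
  obtain ⟨hEc, -, hEu⟩ := D.exterior_of_JCT Literature.Topology.PlaneTopology.JordanCurveTheorem_holds
  have himg : IsConnected (invMap z₀ '' (closure D.carrier)ᶜ) :=
    hEc.image _ ((continuousOn_invMap z₀).mono fun z hz h => hz (h ▸ subset_closure hz₀))
  refine himg.subset_closure subset_union_left ?_
  rintro w (hw | hw)
  · exact subset_closure hw
  · rw [mem_singleton_iff.1 hw, Metric.mem_closure_iff]
    intro ε hε
    obtain ⟨z, hz, hfar⟩ : ∃ z ∈ (closure D.carrier)ᶜ, ε⁻¹ < ‖z - z₀‖ := by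
      by_contra h
      push Not at h
      exact hEu ((isBounded_closedBall (x := z₀) (r := ε⁻¹)).subset fun z hz =>
        mem_closedBall_iff_norm.2 (h z hz))
    refine ⟨invMap z₀ z, ⟨z, hz, rfl⟩, ?_⟩
    rw [dist_comm, dist_zero_right, norm_invMap]
    have h0 : 0 < ‖z - z₀‖ := (inv_pos.2 hε).trans hfar
    rwa [inv_lt_comm₀ h0 hε]

/-- The frontier of the inverted carrier is `ι(∂D)`. [folklore] -/
theorem frontier_invCarrier (hz₀ : z₀ ∈ D.carrier) : frontier (D.invCarrier z₀) = invMap z₀ '' frontier D.carrier := by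
  obtain ⟨-, hEf, -⟩ := D.exterior_of_JCT Literature.Topology.PlaneTopology.JordanCurveTheorem_holds
  have hopen := D.isOpen_invCarrier hz₀
  apply Subset.antisymm
  · intro w hw
    have hwC : w ∉ D.invCarrier z₀ := fun h => hw.2 (by rwa [hopen.interior_eq])
    rw [mem_invCarrier_iff, not_or, not_not] at hwC
    obtain ⟨hw0, hqD⟩ := hwC
    -- `q = κ w` is in `closure D` and in the closure of the exterior
    have hqE : invMapInv z₀ w ∈ closure ((closure D.carrier)ᶜ) := by
      have h1 : invMapInv z₀ w ∈ closure (invMapInv z₀ '' D.invCarrier z₀) :=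
        (continuousAt_invMapInv hw0).continuousWithinAt.mem_closure_image hw.1
      have h2 : invMapInv z₀ '' D.invCarrier z₀ ⊆ (closure D.carrier)ᶜ ∪ {z₀} := by
        rintro _ ⟨w', hw', rfl⟩
        rcases (D.mem_invCarrier_iff).1 hw' with h | h
        · exact Or.inr (by rw [h]; simp [invMapInv])
        · exact Or.inl h
      have h3 := closure_mono h2 h1
      rw [closure_union, closure_singleton] at h3
      rcases h3 with h | h
      · exact h
      · exact absurd (invMapInv_eq_iff.1 h) hw0
    have hqfr : invMapInv z₀ w ∈ frontier D.carrier := by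
      apply frontier_closure_subset
      rw [closure_compl] at hqE
      exact ⟨by rwa [closure_closure], hqE⟩
    exact ⟨_, hqfr, invMap_invMapInv z₀ w⟩
  · rintro _ ⟨q, hq, rfl⟩
    have hq0 : q ≠ z₀ := fun h => Set.disjoint_left.1 D.disjoint_carrier_frontier hz₀ (h ▸ hq)
    have hqE : q ∈ frontier ((closure D.carrier)ᶜ) := by rwa [hEf]
    refine ⟨?_, ?_⟩
    · have h1 : invMap z₀ q ∈ closure (invMap z₀ '' (closure D.carrier)ᶜ) :=
        (continuousAt_invMap hq0).continuousWithinAt.mem_closure_image (frontier_subset_closure hqE)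
      exact closure_mono subset_union_left h1
    · rw [hopen.interior_eq]
      intro hmem
      rcases (D.mem_invCarrier_iff).1 hmem with h0 | hE
      · exact hq0 (invMap_eq_zero_iff.1 h0)
      · rw [invMapInv_invMap] at hE
        exact hE (frontier_subset_closure hq)

/-- **The inverted exterior** `D* = ι(ℂ ∖ closure D) ∪ {0}` of a Jordan domain `D` with respect to
a centre `z₀ ∈ D`, as a Jordan domain with boundary loop `ι ∘ ∂D` (see the module docstring).
[cite: Pommerenke1992, §2.1] -/
def inverted (hz₀ : z₀ ∈ D.carrier) : JordanDomain where
  carrier := D.invCarrier z₀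
  boundary t := invMap z₀ (D.boundary t)
  isOpen := D.isOpen_invCarrier hz₀
  isBounded := D.isBounded_invCarrier hz₀
  isConnected := D.isConnected_invCarrier hz₀
  continuous_boundary :=
    continuous_iff_continuousAt.2 fun t =>
      (continuousAt_invMap (D.boundary_ne_of_mem hz₀ t)).comp D.continuous_boundary.continuousAt
  periodic_boundary t := by simp only [D.periodic_boundary t]
  injOn_boundary _ hs _ ht h := D.injOn_boundary hs ht (invMap_injective z₀ h)
  range_boundary := by
    rw [D.frontier_invCarrier hz₀, ← D.range_boundary, ← range_comp]
    rfl

/-- The carrier of the inverted exterior. [folklore] -/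
@[simp] theorem inverted_carrier (hz₀ : z₀ ∈ D.carrier) : (D.inverted hz₀).carrier = D.invCarrier z₀ := rfl

/-- The boundary loop of the inverted exterior is `ι ∘ ∂D`. [folklore] -/
@[simp] theorem inverted_boundary (hz₀ : z₀ ∈ D.carrier) (t : ℝ) :
    (D.inverted hz₀).boundary t = invMap z₀ (D.boundary t) := rfl

/-- `0 ∈ D*`. [folklore] -/
theorem zero_mem_inverted (hz₀ : z₀ ∈ D.carrier) : (0 : ℂ) ∈ (D.inverted hz₀).carrier := D.zero_mem_invCarrier

/-- Exterior points invert into `D*`. [folklore] -/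
theorem invMap_mem_inverted (hz₀ : z₀ ∈ D.carrier) {z : ℂ} (hz : z ∉ closure D.carrier) :
    invMap z₀ z ∈ (D.inverted hz₀).carrier :=
  D.invMap_mem_invCarrier hz

/-- Nonzero points of `D*` invert back into the exterior. [folklore] -/
theorem invMapInv_not_mem_closure (hz₀ : z₀ ∈ D.carrier) {w : ℂ} (hw : w ∈ (D.inverted hz₀).carrier) (hw0 : w ≠ 0) :
    invMapInv z₀ w ∉ closure D.carrier :=
  ((D.mem_invCarrier_iff).1 hw).resolve_left hw0

/-- The frontier of `D*` is `ι(∂D)`. [folklore] -/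
theorem frontier_inverted (hz₀ : z₀ ∈ D.carrier) :
    frontier (D.inverted hz₀).carrier = invMap z₀ '' frontier D.carrier :=
  D.frontier_invCarrier hz₀

end JordanDomain

end Literature.Probability.RandomPlanarGeometry
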